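import Literature.Geometry.Riemannian.SphericalCylinderKernelCertificate
import Literature.Geometry.Riemannian.LowEntropyHypersurfacesFourProofs
import Summits.SmoothPoincare4.SmoothPoincare4.Theorems.CylinderEntropySliceIsolationCentreDomination
import Mathlib
import HarnessLib

/-!
# Domination bookkeeping for the conformal kernel domination (stub `stub_dominationBookkeeping`)

Helper for the line `conformal-kernel-domination` of the crux
`Summit.SmoothPoincare4.SmoothPoincare4.Theses.CylinderEntropy.SliceIsolation` (crux item
stmt-SmoothPoincare4-7632).  Let `N = {z ∈ ℝ⁶ | ∑_{i<5} zᵢ² = 1} = S⁴ × ℝ`, `Φ(z) = e^{z₅} z' ∈ ℝ⁵`,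
`λ_cyl` the typed cylinder entropy (`cylEntropy`) and `λ_E` the Colding–Minicozzi entropy
(`gaussianEntropy 4`) of subsets of `ℝ⁵`.  In the normalised variables `T = t/‖y‖² > 0`,
`u = z₅ − log ‖y‖`, `s = ⟨z', ŷ⟩ ∈ [−1, 1]` the Jacobian-weighted pulled-back Euclidean Gaussian kernel
times `V = 8π²/3` is
`pulled(T,u,s) = (8π²/3)·((4πT)²)⁻¹·exp(4u)·exp(−(exp(2u) − 2·exp(u)·s + 1)/(4T))`.
A CERTIFICATE of mass `≤ C` at scale `T` is a finite family of on-axis cylinder ("zonal") kernels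
`w_j · 𝔥(τ_j, s) · exp(−(u − σ_j)²/(4τ_j))` plus an area atom `c` dominating `pulled(T,·,·)` on
`ℝ × [−1, 1]`, with `∑ w_j + c ≤ C`.

We prove the pure measure-theoretic BOOKKEEPING: if `C ≥ λ(S⁴) = 32/(3e²)` and certificates of mass
`≤ C` exist at every `T > 0`, then `λ_E(Φ A) ≤ C · λ_cyl(A)` for every measurable `A ⊆ N` (of bounded
height; the height bound is not even needed).

Proof.  `λ_E = sup_{y, t > 0} F_{y,t}`.  For the centre `y = 0` the tree's
`gaussianArea_zero_conformal_le` gives `F_{0,t}(Φ A) ≤ λ(S⁴) λ_cyl(A) ≤ C λ_cyl(A)`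
(`gaussianEntropy_sphere_four`).  For `y ≠ 0` put `r = ‖y‖`, `T = t/r²` and take a certificate
`(σ_j, τ_j, w_j)_j, c` at scale `T`; with the cylinder centres `p_j = (ŷ, log r + σ_j) ∈ N` the identity
`‖Φ z − y‖² = r² (exp(2u) − 2 exp(u) s + 1)` (`norm_conf_sub_sq`, `u = z₅ − log r`, `s = ⟨z', ŷ⟩`)
turns the certificate inequality into the pointwise domination
`(4πt)⁻² e^{4z₅} e^{−‖Φz − y‖²/4t} ≤ V⁻¹ (∑_j w_j K_{p_j,τ_j}(z) + c)` on `N`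
(`K = cylKernel`, `cylKernel_eq`), and the tree's certificate-integration theorem
`SphericalCylinderConformal.gaussianArea_conformal_le_of_certificate` (layer-cake pushforward,
`V⁻¹ ∫_A K = F̂ ≤ λ_cyl`, `V⁻¹ μHE⁴(A) ≤ λ_cyl`, `h → 0`) gives `F_{y,t}(Φ A) ≤ (∑ w_j + c) λ_cyl(A)`.
-/

noncomputable section

open MeasureTheory Set
open scoped ENNReal NNReal BigOperators

-- the registered namespace `Summit.SmoothPoincare4.SmoothPoincare4.Theorems…` repeats a component
set_option linter.dupNamespace false

namespace Summit.SmoothPoincare4.SmoothPoincare4.Theorems.CylinderEntropySliceIsolation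

open Literature.Geometry.Manifold.CylinderSlice (padL axis castSucc_ne_five)
open Literature.Geometry.Riemannian Literature.Geometry.Riemannian.SphericalCylinderEntropy
open Literature.Geometry.Riemannian.SphericalCylinderConformal (center_mem norm_conf_sub_sq
  gaussianArea_conformal_le_of_certificate)

/-- The shifted matching cylinder centres `(ŷ, a) ∈ N` of a Euclidean centre `y ≠ 0`: the point
`padL ŷ + a • e₅` lies on `N`, its base point is `ŷ = y/‖y‖` and its height is `a`. [folklore] -/
theorem dominationBookkeeping_centre {y : EuclideanSpace ℝ (Fin 5)} (hy : y ≠ 0) (a : ℝ) :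
    (∑ i : Fin 5, (padL (‖y‖⁻¹ • y) + a • axis) (Fin.castSucc i) ^ 2 = 1) ∧
    (∀ i : Fin 5, (padL (‖y‖⁻¹ • y) + a • axis) (Fin.castSucc i) = (‖y‖⁻¹ • y) i) ∧
    (padL (‖y‖⁻¹ • y) + a • axis) 5 = a := by
  have hr : 0 < ‖y‖ := norm_pos_iff.2 hy
  have hcoord : ∀ i : Fin 5, (padL (‖y‖⁻¹ • y) + a • axis) (Fin.castSucc i) = (‖y‖⁻¹ • y) i := by
    intro i
    simp [axis, castSucc_ne_five i]
  have hlast : (padL (‖y‖⁻¹ • y) + a • axis) 5 = a := by simp [axis]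
  refine ⟨?_, hcoord, hlast⟩
  simp only [hcoord]
  have h1 : ‖(‖y‖⁻¹ • y)‖ = 1 := by rw [norm_smul, norm_inv, norm_norm, inv_mul_cancel₀ hr.ne']
  have h2 := EuclideanSpace.real_norm_sq_eq (‖y‖⁻¹ • y)
  rw [h1, one_pow] at h2
  exact h2.symm

/-- **The pulled-back kernel in normalised variables.** For `z ∈ N`, `y ≠ 0` (`r = ‖y‖`, `T = t/r²`,
`u = z₅ − log r`, `s = ⟨z', ŷ⟩`):
`(4πt)⁻² e^{4z₅} e^{−‖Φz − y‖²/4t} = V⁻¹ · [V (4πT)⁻² e^{4u} e^{−(e^{2u} − 2eᵘs + 1)/4T}]`, `V = 8π²/3`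
(from `‖Φz − y‖² = r²((eᵘ − 1)² + 2eᵘ(1 − s))`, `e^{z₅} = r eᵘ`). [folklore] -/
theorem dominationBookkeeping_pulled {z : EuclideanSpace ℝ (Fin 6)}
    (hz : ∑ i : Fin 5, z (Fin.castSucc i) ^ 2 = 1) {y : EuclideanSpace ℝ (Fin 5)} (hy : y ≠ 0)
    {t : ℝ} (ht : 0 < t) :
    ((4 * Real.pi * t) ^ 2)⁻¹ * Real.exp (4 * z 5) *
        Real.exp (-‖(WithLp.toLp 2 (fun i : Fin 5 => Real.exp (z 5) * z (Fin.castSucc i)) :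
          EuclideanSpace ℝ (Fin 5)) - y‖ ^ 2 / (4 * t)) =
      (3 / (8 * Real.pi ^ 2)) *
        ((8 * Real.pi ^ 2 / 3) * ((4 * Real.pi * (t / ‖y‖ ^ 2)) ^ 2)⁻¹ *
          Real.exp (4 * (z 5 - Real.log ‖y‖)) *
          Real.exp (-(Real.exp (2 * (z 5 - Real.log ‖y‖)) -
              2 * Real.exp (z 5 - Real.log ‖y‖) *
                (∑ i : Fin 5, z (Fin.castSucc i) * (‖y‖⁻¹ • y) i) + 1) /
            (4 * (t / ‖y‖ ^ 2)))) := by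
  have hr : 0 < ‖y‖ := norm_pos_iff.2 hy
  have hr' : ‖y‖ ≠ 0 := hr.ne'
  have ht' : t ≠ 0 := ht.ne'
  have hπ : Real.pi ≠ 0 := Real.pi_ne_zero
  rw [norm_conf_sub_sq hz hy]
  set s := ∑ i : Fin 5, z (Fin.castSucc i) * (‖y‖⁻¹ • y) i with hs_def
  set u := z 5 - Real.log ‖y‖ with hu_def
  have hu : z 5 = u + Real.log ‖y‖ := by rw [hu_def]; ring
  have he5 : Real.exp (z 5) = Real.exp u * ‖y‖ := by rw [hu, Real.exp_add, Real.exp_log hr]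
  have h4z : Real.exp (4 * z 5) = (Real.exp u * ‖y‖) ^ 4 := by
    rw [← he5, ← Real.exp_nat_mul]; norm_num
  have h4u : Real.exp (4 * u) = Real.exp u ^ 4 := by rw [← Real.exp_nat_mul]; norm_num
  have h2u : Real.exp (2 * u) = Real.exp u ^ 2 := by rw [← Real.exp_nat_mul]; norm_num
  rw [he5, h4z, h4u, h2u]
  have harg : -(‖y‖ ^ 2 * ((Real.exp u * ‖y‖ / ‖y‖ - 1) ^ 2 +
      2 * (Real.exp u * ‖y‖ / ‖y‖) * (1 - s))) / (4 * t) =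
        -(Real.exp u ^ 2 - 2 * Real.exp u * s + 1) / (4 * (t / ‖y‖ ^ 2)) := by
    field_simp
    ring
  rw [harg]
  have hpref : ((4 * Real.pi * t) ^ 2)⁻¹ * (Real.exp u * ‖y‖) ^ 4 =
      (3 / (8 * Real.pi ^ 2)) * ((8 * Real.pi ^ 2 / 3) * ((4 * Real.pi * (t / ‖y‖ ^ 2)) ^ 2)⁻¹ *
        Real.exp u ^ 4) := by
    field_simp
  rw [hpref]
  ring

/-- **Off-centre domination from a normalised certificate.** If at the normalised scale `T = t/‖y‖²`
(`y ≠ 0`, `t > 0`) a zonal certificate `(σ_j, τ_j, w_j)_j, c` of mass `≤ C` dominates the pulled-back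
kernel on `ℝ × [−1, 1]`, then `F_{y,t}(Φ A) ≤ C · λ_cyl(A)` for every measurable `A ⊆ N`: the centres
`p_j = (ŷ, log ‖y‖ + σ_j) ∈ N` turn it into a pointwise domination by `V⁻¹(∑ w_j K_{p_j,τ_j} + c)`, which
integrates by `gaussianArea_conformal_le_of_certificate`. [folklore] -/
theorem dominationBookkeeping_offCentre {C : ℝ}
    (hcert : ∀ T : ℝ, 0 < T →
        ∃ (n : ℕ) (σ τ w : Fin n → ℝ) (c : ℝ), (∀ j, 0 < τ j) ∧ (∀ j, 0 ≤ w j) ∧ 0 ≤ c ∧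
          (∑ j, w j) + c ≤ C ∧
          ∀ u s : ℝ, -1 ≤ s → s ≤ 1 →
            (8 * Real.pi ^ 2 / 3) * ((4 * Real.pi * T) ^ 2)⁻¹ * Real.exp (4 * u) *
                Real.exp (-(Real.exp (2 * u) - 2 * Real.exp u * s + 1) / (4 * T)) ≤
              (∑ j, w j * (zonal (τ j) s * Real.exp (-(u - σ j) ^ 2 / (4 * τ j)))) + c)
    {A : Set (EuclideanSpace ℝ (Fin 6))}
    (hAN : A ⊆ {z : EuclideanSpace ℝ (Fin 6) | ∑ i : Fin 5, z (Fin.castSucc i) ^ 2 = 1})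
    (hAm : MeasurableSet A) {y : EuclideanSpace ℝ (Fin 5)} (hy : y ≠ 0) {t : ℝ} (ht : 0 < t) :
    gaussianArea 4 y t
        ((fun z : EuclideanSpace ℝ (Fin 6) =>
          (WithLp.toLp 2 (fun i : Fin 5 => Real.exp (z 5) * z (Fin.castSucc i)) :
            EuclideanSpace ℝ (Fin 5))) '' A) ≤
      ENNReal.ofReal C * cylEntropy A := by
  have hr : 0 < ‖y‖ := norm_pos_iff.2 hy
  have hπ := Real.pi_pos
  obtain ⟨n, σ, τ, w, c, hτ, hw, hc, hmass, hpt⟩ := hcert (t / ‖y‖ ^ 2) (by positivity)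
  obtain ⟨h0N, h0c, -⟩ := center_mem hy
  -- the shifted centres `p_j = (ŷ, log ‖y‖ + σ_j)`
  set p : Fin n → EuclideanSpace ℝ (Fin 6) := fun j =>
    padL (‖y‖⁻¹ • y) + (Real.log ‖y‖ + σ j) • axis with hp_def
  have hpN : ∀ j, ∑ i : Fin 5, p j (Fin.castSucc i) ^ 2 = 1 := fun j =>
    (dominationBookkeeping_centre hy (Real.log ‖y‖ + σ j)).1
  have hpc : ∀ j, ∀ i : Fin 5, p j (Fin.castSucc i) = (‖y‖⁻¹ • y) i := fun j =>
    (dominationBookkeeping_centre hy (Real.log ‖y‖ + σ j)).2.1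
  have hp5 : ∀ j, p j 5 = Real.log ‖y‖ + σ j := fun j =>
    (dominationBookkeeping_centre hy (Real.log ‖y‖ + σ j)).2.2
  calc gaussianArea 4 y t
        ((fun z : EuclideanSpace ℝ (Fin 6) =>
          (WithLp.toLp 2 (fun i : Fin 5 => Real.exp (z 5) * z (Fin.castSucc i)) :
            EuclideanSpace ℝ (Fin 5))) '' A)
      ≤ ENNReal.ofReal (∑ j, w j + c) * cylEntropy A := by
        refine gaussianArea_conformal_le_of_certificate hw hpN hτ hc ht (fun z hz => ?_) A hAN hAm
        -- the pointwise domination at `z ∈ N`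
        set s := ∑ i : Fin 5, z (Fin.castSucc i) * (‖y‖⁻¹ • y) i with hs_def
        have hPp : ∑ i : Fin 5, z (Fin.castSucc i) *
            (padL (‖y‖⁻¹ • y) + Real.log ‖y‖ • axis) (Fin.castSucc i) = s :=
          Finset.sum_congr rfl fun i _ => by rw [h0c i]
        have hsabs : |s| ≤ 1 := by
          rw [← hPp]
          exact abs_sum_mul_le_one hz h0N
        obtain ⟨hs1, hs2⟩ := abs_le.1 hsabs
        have hK : ∀ j, cylKernel (p j) (τ j) z =
            zonal (τ j) s * Real.exp (-(z 5 - Real.log ‖y‖ - σ j) ^ 2 / (4 * τ j)) := by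
          intro j
          have hPj : ∑ i : Fin 5, z (Fin.castSucc i) * p j (Fin.castSucc i) = s :=
            Finset.sum_congr rfl fun i _ => by rw [hpc j i]
          rw [cylKernel_eq, hPj, hp5 j, show z 5 - (Real.log ‖y‖ + σ j) = z 5 - Real.log ‖y‖ - σ j by ring]
        have h := hpt (z 5 - Real.log ‖y‖) s hs1 hs2
        rw [dominationBookkeeping_pulled hz hy ht]
        refine mul_le_mul_of_nonneg_left (h.trans_eq ?_) (by positivity)
        congr 1
        exact Finset.sum_congr rfl fun j _ => by rw [hK j]
    _ ≤ ENNReal.ofReal C * cylEntropy A := by gcongr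

/-- **Domination bookkeeping** (registered stub `stub_dominationBookkeeping` of the line
`conformal-kernel-domination`): certificates of mass `≤ C` at every normalised scale, with
`C ≥ λ(S⁴) = 32/(3e²)` for the centre `y = 0`, give `λ_E(Φ A) ≤ C · λ_cyl(A)` for every bounded
measurable `A ⊆ N`. [folklore] -/
theorem stub_dominationBookkeeping :
    ∀ C : ℝ, 32 / (3 * Real.exp 1 ^ 2) ≤ C →
      (∀ T : ℝ, 0 < T →
        ∃ (n : ℕ) (σ τ w : Fin n → ℝ) (c : ℝ), (∀ j, 0 < τ j) ∧ (∀ j, 0 ≤ w j) ∧ 0 ≤ c ∧ (∑ j, w j) + c ≤ C ∧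
          ∀ u s : ℝ, -1 ≤ s → s ≤ 1 →
            (8 * Real.pi ^ 2 / 3) * ((4 * Real.pi * T) ^ 2)⁻¹ * Real.exp (4 * u) *
                Real.exp (-(Real.exp (2 * u) - 2 * Real.exp u * s + 1) / (4 * T)) ≤
              (∑ j, w j * (zonal (τ j) s * Real.exp (-(u - σ j) ^ 2 / (4 * τ j)))) + c) →
      ∀ A : Set (EuclideanSpace ℝ (Fin 6)),
        A ⊆ {z : EuclideanSpace ℝ (Fin 6) | ∑ i : Fin 5, z (Fin.castSucc i) ^ 2 = 1} → MeasurableSet A →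
        (∃ B : ℝ, ∀ z ∈ A, |z 5| ≤ B) →
          gaussianEntropy 4
            ((fun z : EuclideanSpace ℝ (Fin 6) =>
              (WithLp.toLp 2 (fun i : Fin 5 => Real.exp (z 5) * z (Fin.castSucc i)) : EuclideanSpace ℝ (Fin 5))) '' A) ≤
            ENNReal.ofReal C * cylEntropy A := by
  intro C hC hcert A hAN hAm _
  rw [gaussianEntropy_eq_iSup]
  refine iSup_le fun y => iSup_le fun t => iSup_le fun ht => ?_
  rcases eq_or_ne y 0 with rfl | hy
  · calc _ ≤ gaussianEntropy 4 (Metric.sphere (0 : EuclideanSpace ℝ (Fin 5)) 1) * cylEntropy A :=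
          gaussianArea_zero_conformal_le A hAN hAm t ht
      _ ≤ ENNReal.ofReal C * cylEntropy A := by
          rw [gaussianEntropy_sphere_four (0 : EuclideanSpace ℝ (Fin 5)) one_pos]
          gcongr
  · exact dominationBookkeeping_offCentre hcert hAN hAm hy ht

end Summit.SmoothPoincare4.SmoothPoincare4.Theorems.CylinderEntropySliceIsolation

end
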